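import Mathlib
import Summits.Ventures.PercRepro2.HalfLA2OCerts

/-!
# `0 ≤ HalfLA2O.lhs` from the certificates (blind cell PercRepro2, night-1 g37)
-/

namespace Summit.Ventures.PercRepro2

namespace HalfLA2O

section Nonneg

variable {R : Type*} [CommRing R] [LinearOrder R] [IsStrictOrderedRing R]

/-- All ten cells nonnegative. -/
def Cells10.Nonneg (c : Cells10 R) : Prop :=
  0 ≤ c.LL ∧ 0 ≤ c.LH ∧ 0 ≤ c.LN ∧ 0 ≤ c.HL ∧ 0 ≤ c.HH ∧ 0 ≤ c.HN ∧ 0 ≤ c.NL ∧ 0 ≤ c.NH ∧ 0 ≤ c.NNs ∧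
    0 ≤ c.NNd

/-- The blocks nonnegative. -/
def BlocksNonneg (c : Cells10 R) : Prop :=
  0 ≤ blkLL c ∧ 0 ≤ blkHHN c

/-- `0 ≤ C00`. -/
theorem C00_nonneg (c : Cells10 R) (hc : c.Nonneg) (hb : BlocksNonneg c) : 0 ≤ C00 c := by
  obtain ⟨hLL, hLH, hLN, hHL, hHH, hHN, hNL, hNH, hNNs, hNNd⟩ := hc
  obtain ⟨bLL, bHHN⟩ := hb
  unfold C00
  exact add_nonneg (add_nonneg (add_nonneg (add_nonneg (add_nonneg (add_nonneg (add_nonneg (add_nonneg (add_nonneg (mul_nonneg (by positivity) (mul_nonneg hLL bHHN)) (mul_nonneg (by positivity) (mul_nonneg hLH bHHN))) (mul_nonneg (by positivity) (mul_nonneg hLN bHHN))) (mul_nonneg (by positivity) (mul_nonneg hHL bHHN))) (mul_nonneg (by positivity) (mul_nonneg hHH bHHN))) (mul_nonneg (by positivity) (mul_nonneg hHN bHHN))) (mul_nonneg (by positivity) (mul_nonneg hNL bHHN))) (mul_nonneg (by positivity) (mul_nonneg hNH bHHN))) (mul_nonneg (by positivity) (mul_nonneg hNNs bHHN))) (mul_nonneg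 (by positivity) (mul_nonneg hNNd bHHN))

/-- `0 ≤ C01`. -/
theorem C01_nonneg (c : Cells10 R) (hc : c.Nonneg) (hb : BlocksNonneg c) : 0 ≤ C01 c := by
  obtain ⟨hLL, hLH, hLN, hHL, hHH, hHN, hNL, hNH, hNNs, hNNd⟩ := hc
  obtain ⟨bLL, bHHN⟩ := hb
  unfold C01
  exact add_nonneg (add_nonneg (add_nonneg (add_nonneg (add_nonneg (add_nonneg (add_nonneg (add_nonneg (add_nonneg (mul_nonneg (by positivity) (mul_nonneg hLL bHHN)) (mul_nonneg (by positivity) (mul_nonneg hLH bHHN))) (mul_nonneg (by positivity) (mul_nonneg hLN bHHN))) (mul_nonneg (by positivity) (mul_nonneg hHL bHHN))) (mul_nonneg (by positivity) (mul_nonneg hHH bHHN))) (mul_nonneg (by positivity) (mul_nonneg hHN bHHN))) (mul_nonneg (by positivity) (mul_nonneg hNL bHHN))) (mul_nonneg (by positivity) (mul_nonneg hNH bHHN))) (mul_nonneg (by positivity) (mul_nonneg hNNs bHHN))) (mul_nonneg (by positivity) (mul_nonneg hNNd bHHN))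

/-- `0 ≤ C10`. -/
theorem C10_nonneg (c : Cells10 R) (hc : c.Nonneg) (hb : BlocksNonneg c) : 0 ≤ C10 c := by
  obtain ⟨hLL, hLH, hLN, hHL, hHH, hHN, hNL, hNH, hNNs, hNNd⟩ := hc
  obtain ⟨bLL, bHHN⟩ := hb
  unfold C10
  exact add_nonneg (add_nonneg (add_nonneg (add_nonneg (add_nonneg (add_nonneg (add_nonneg (add_nonneg (add_nonneg (add_nonneg (add_nonneg (add_nonneg (add_nonneg (add_nonneg (add_nonneg (add_nonneg (add_nonneg (add_nonneg (add_nonneg (mul_nonneg (by positivity) (mul_nonneg hLL bLL)) (mul_nonneg (by positivity) (mul_nonneg hLH bLL))) (mul_nonneg (by positivity) (mul_nonneg hLN bLL))) (mul_nonneg (by positivity) (mul_nonneg hHL bLL))) (mul_nonneg (by positivity) (mul_nonneg hHH bLL))) (mul_nonneg (by positivity) (mul_nonneg hHN bLL))) (mul_nonneg (by positivity) (mul_nonneg hNL bLL))) (mul_nonneg (by positivity) (mul_nonneg hNH bLL))) (mul_nonneg (by positivity) (mul_nonneg hNNs bLL))) (mul_nonneg (by positivity) (mul_nonneg hNNd bLL)))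 (mul_nonneg (by positivity) (mul_nonneg hLL bHHN))) (mul_nonneg (by positivity) (mul_nonneg hLH bHHN))) (mul_nonneg (by positivity) (mul_nonneg hLN bHHN))) (mul_nonneg (by positivity) (mul_nonneg hHL bHHN))) (mul_nonneg (by positivity) (mul_nonneg hHH bHHN))) (mul_nonneg (by positivity) (mul_nonneg hHN bHHN))) (mul_nonneg (by positivity) (mul_nonneg hNL bHHN))) (mul_nonneg (by positivity) (mul_nonneg hNH bHHN))) (mul_nonneg (by positivity) (mul_nonneg hNNs bHHN))) (mul_nonneg (by positivity) (mul_nonneg hNNd bHHN))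

/-- `0 ≤ C11`. -/
theorem C11_nonneg (c : Cells10 R) (hc : c.Nonneg) (hb : BlocksNonneg c) : 0 ≤ C11 c := by
  obtain ⟨hLL, hLH, hLN, hHL, hHH, hHN, hNL, hNH, hNNs, hNNd⟩ := hc
  obtain ⟨bLL, bHHN⟩ := hb
  unfold C11
  exact add_nonneg (add_nonneg (add_nonneg (add_nonneg (add_nonneg (add_nonneg (add_nonneg (add_nonneg (add_nonneg (add_nonneg (add_nonneg (add_nonneg (add_nonneg ((mul_nonneg hLL bLL)) ((mul_nonneg hLH bLL))) ((mul_nonneg hLN bLL))) ((mul_nonneg hNL bLL))) ((mul_nonneg hNH bLL))) ((mul_nonneg hNNs bLL))) ((mul_nonneg hNNd bLL))) ((mul_nonneg hHL bHHN))) ((mul_nonneg hHH bHHN))) ((mul_nonneg hHN bHHN))) ((mul_nonneg hNL bHHN))) ((mul_nonneg hNH bHHN))) ((mul_nonneg hNNs bHHN))) ((mul_nonneg hNNd bHHN))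

/-- `0 ≤ C20`. -/
theorem C20_nonneg (c : Cells10 R) (hc : c.Nonneg) (hb : BlocksNonneg c) : 0 ≤ C20 c := by
  obtain ⟨hLL, hLH, hLN, hHL, hHH, hHN, hNL, hNH, hNNs, hNNd⟩ := hc
  obtain ⟨bLL, bHHN⟩ := hb
  unfold C20
  exact add_nonneg (add_nonneg (add_nonneg (add_nonneg (add_nonneg (add_nonneg (add_nonneg (add_nonneg (add_nonneg (mul_nonneg (by positivity) (mul_nonneg hLL bLL)) (mul_nonneg (by positivity) (mul_nonneg hLH bLL))) (mul_nonneg (by positivity) (mul_nonneg hLN bLL))) (mul_nonneg (by positivity) (mul_nonneg hHL bLL))) (mul_nonneg (by positivity) (mul_nonneg hHH bLL))) (mul_nonneg (by positivity) (mul_nonneg hHN bLL))) (mul_nonneg (by positivity) (mul_nonneg hNL bLL))) (mul_nonneg (by positivity) (mul_nonneg hNH bLL))) (mul_nonneg (by positivity) (mul_nonneg hNNs bLL))) (mul_nonneg (by positivity) (mul_nonneg hNNd bLL))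

/-- `0 ≤ C21`. -/
theorem C21_nonneg (c : Cells10 R) (hc : c.Nonneg) (hb : BlocksNonneg c) : 0 ≤ C21 c := by
  obtain ⟨hLL, hLH, hLN, hHL, hHH, hHN, hNL, hNH, hNNs, hNNd⟩ := hc
  obtain ⟨bLL, bHHN⟩ := hb
  unfold C21
  exact add_nonneg (add_nonneg (add_nonneg ((mul_nonneg hNL bLL)) ((mul_nonneg hNH bLL))) ((mul_nonneg hNNs bLL))) ((mul_nonneg hNNd bLL))

/-- **`0 ≤ lhs`** for nonnegative cells and blocks and `r₁, r₂ ∈ [0, 1]`. -/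
theorem lhs_nonneg (r₁ r₂ : R) (c : Cells10 R) (hc : c.Nonneg) (hb : BlocksNonneg c)
    (h1 : 0 ≤ r₁) (h1' : r₁ ≤ 1) (h2 : 0 ≤ r₂) (h2' : r₂ ≤ 1) : 0 ≤ lhs r₁ r₂ c := by
  have e := lhs_bern r₁ r₂ c
  have s1 : 0 ≤ 1 - r₁ := by linarith
  have s2 : 0 ≤ 1 - r₂ := by linarith
  have hN : (0 : R) < 6 := by norm_num
  have key : 0 ≤ 6 * lhs r₁ r₂ c := by
    rw [e]
    have := C00_nonneg c hc hb
    have := C01_nonneg c hc hb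
    have := C10_nonneg c hc hb
    have := C11_nonneg c hc hb
    have := C20_nonneg c hc hb
    have := C21_nonneg c hc hb
    positivity
  exact (mul_nonneg_iff_of_pos_left hN).1 key

end Nonneg

end HalfLA2O

end Summit.Ventures.PercRepro2
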